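import Summits.BirchSwinnertonDyer.BirchSwinnertonDyer.Theorems.PrintCFramBottomClassIndexLawFiveLeFlipRungLowerUnipotentAssembly
import Summits.BirchSwinnertonDyer.BirchSwinnertonDyer.Theorems.PrintCFramBottomClassIndexLawFiveLeFlipRungLowerSlashCoeff
import Summits.BirchSwinnertonDyer.BirchSwinnertonDyer.Theorems.PrintCFramBottomClassIndexLawFiveLeFlipRungAllOfJML
import Summits.BirchSwinnertonDyer.BirchSwinnertonDyer.Theorems.PrintCFramBottomClassIndexLawFiveLeFlipRungAllOfRungAll
import HarnessLib

set_option autoImplicit false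

/-!
# Crux `PrintCFram.BottomClassIndexLawFiveLe` (stmt-BirchSwinnertonDyer-20372), line `eisenstein-resource-bdp-line` (registry v29 → v30):
# «T8 — THE LOWER-UNIPOTENT RUNG» CLOSED MODULO NF-A ∧ NF-Q: `jmlAll_six_of_facts`, `rungAll_six_of_facts`, `flipRungAll_six_of_facts`
# (the joint modular lemma, the Cohen-number rung and (FlipRungAll⁶) = registry v29's `stub_flipRungs.1`, from the two cite-only facts ALONE —
# Raum 2023 Prop. 2.3 re-proved in the kernel through the lower-unipotent rung; no new named fact)
# (cell `bsd-print-cfram`, width seat `bsd-line-cfram-p1-w3` g19; THEOREMS ONLY, `--supports` 20372; BSD is not proved by any of this)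

HONEST FRAMING. One composition, no new mathematics: the per-cusp socket (LowerSocket⁶) of `FlipRung.jmlAll_six_of_socket` (T8-7, this seat) is
DISCHARGED by seat w5 g8's `FlipRung.exists_isIntegral_lowerUnipotent_coeff` ((U1)(U2) decomposition + coefficient corollary + NF-Q via T4 §3,
p711370). With seat w8 g9's `rungAll_six_of_jmlAll` and seat w2 g15's `flipRungAll_six_of_rungAll` this yields (FlipRungAll⁶) = registry v29's
`stub_flipRungs.1` from NF-A ∧ NF-Q. CONDITIONAL on NF-A and NF-Q (hypotheses, cite-only). No new definitions, no named facts, no `sorry`.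
beyond-print theorem: NO. BSD is not proved by any of this; no summit statement is proved by this seat; no registered stub is closed by this file.

References: M. Raum, Forum Math. 35 (2023) 615–646, Prop. 2.3 [Raum2023RamanujanTypeII]; [Cohen1975] Thm. 3.1; [Katz1973] §1.6 Cor. 1.6.2.
-/

-- summit-side namespace `Summit.BirchSwinnertonDyer.BirchSwinnertonDyer.…` (single-conjunct summit, D-0017 layout)
set_option linter.dupNamespace false

noncomputable section

namespace Summit.BirchSwinnertonDyer.BirchSwinnertonDyer.Theorems.PrintCFram.FlipRung

open UpperHalfPlane hiding I
open Filter Function Complex CongruenceSubgroup PowerSeries Finset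
open scoped MatrixGroups ModularForm Topology Manifold Real NumberTheorySymbols Classical
open Literature.NumberTheory.ModularForms Literature.NumberTheory.ModularForms.CohenEisenstein
open NumberField DirichletCharacter Literature.NumberTheory.LFunctions
  Literature.NumberTheory.EllipticCurves Literature.NumberTheory.EllipticCurves.KrizLi2019
  Literature.NumberTheory.QuadraticFields
open Summit.BirchSwinnertonDyer.BirchSwinnertonDyer.Theorems.PrintCFram

/-- **(JMLall⁶) FROM NF-A ∧ NF-Q** — seat w8 g9's frozen interface of the lower-unipotent rung (HOME/STATUS 2026-08-29T09:14:36Z): for every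
class datum, sign pattern `τ`, odd prime `q ∣ m`, `q ∤ v` and cut coefficient function `a`, witnesses `N, D, Θ` such that «class `n ≡ qv (mod q²)`
of `a ⋆ Θ` in `p·ℤ̄[1/N]` ⟹ `‖(a ⋆ Θ)(n)‖_p ≤ p⁻¹` for every `q ∥ n`» — `jmlAll_six_of_socket` with its per-cusp socket discharged by
`exists_isIntegral_lowerUnipotent_coeff`. CONDITIONAL on NF-A and NF-Q (hypotheses). [cite: Raum2023RamanujanTypeII, Prop. 2.3]
[cite: Cohen1975, Thm. 3.1] [cite: Katz1973, §1.6 Cor. 1.6.2] -/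
theorem jmlAll_six_of_facts
    (hA : Cohen1975.thm31_cohenSeries_mem_halfIntModularForms)
    (hKatz : Katz1973_qExpansionPrinciple_allCusps) :
    ∀ (p : ℕ) [Fact p.Prime] (m : ℕ) [NeZero m] (χ : DirichletCharacter ℚ_[p] m) (k : ℕ),
      (p = 7 ∨ p = 11 ∨ p = 19 ∨ p = 43 ∨ p = 67 ∨ p = 163) →
      m.Coprime p → χ.IsPrimitive → χ.IsQuadratic → (k = (p + 1) / 4 ∨ k = (3 * p - 1) / 4) →
      2 ≤ k → k ≤ p - 2 → χ (-1) * (-1) ^ k = -1 →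
      ∀ (τ : ℕ → ℤ) (q : ℕ), q.Prime → q ∣ m → q ≠ 2 →
      (∀ q' : ℕ, q'.Prime → q' ∣ m → q' ≠ 2 → (τ q' = 1 ∨ τ q' = -1)) →
      ∀ (v : ℕ), ¬ q ∣ v →
      ∀ (a : ℕ → ℚ),
        (∀ i : ℕ, (m / q ∣ i ∧ i / (m / q) % 4 = 3 * q % 4 ∧
            (∀ q' : ℕ, q'.Prime → q' ∣ m / q → q' ≠ 2 →
              jacobiSym (-((i / (m / q) : ℕ) : ℤ)) q' = τ q' * jacobiSym (q : ℤ) q') ∧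
            (2 ∣ m → i / (m / q) % 8 = 7 * q % 8) ∧ (q ≠ 3 → ¬ 3 ∣ i / (m / q))) → a i = cohenH k i) →
        (∀ i : ℕ, ¬ (m / q ∣ i ∧ i / (m / q) % 4 = 3 * q % 4 ∧
            (∀ q' : ℕ, q'.Prime → q' ∣ m / q → q' ≠ 2 →
              jacobiSym (-((i / (m / q) : ℕ) : ℤ)) q' = τ q' * jacobiSym (q : ℤ) q') ∧
            (2 ∣ m → i / (m / q) % 8 = 7 * q % 8) ∧ (q ≠ 3 → ¬ 3 ∣ i / (m / q))) → a i = 0) →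
      ∃ (N D : ℕ) (Θ : PowerSeries ℕ),
        ¬ p ∣ N ∧ 2 ∣ N ∧ q ^ 2 ∣ D ∧
        Function.Periodic (fun i : ℕ => (m / q ∣ i ∧ i / (m / q) % 4 = 3 * q % 4 ∧
            (∀ q' : ℕ, q'.Prime → q' ∣ m / q → q' ≠ 2 →
              jacobiSym (-((i / (m / q) : ℕ) : ℤ)) q' = τ q' * jacobiSym (q : ℤ) q') ∧
            (2 ∣ m → i / (m / q) % 8 = 7 * q % 8) ∧ (q ≠ 3 → ¬ 3 ∣ i / (m / q)))) D ∧
        PowerSeries.coeff 0 Θ = 1 ∧ (∀ j : ℕ, PowerSeries.coeff j Θ ≠ 0 → D ∣ j) ∧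
        ((∀ n : ℕ, n % q ^ 2 = q * v % q ^ 2 →
            ∃ y : ℂ, (∃ j : ℕ, IsIntegral ℤ ((N : ℂ) ^ j * y)) ∧
              ((PowerSeries.coeff n (PowerSeries.mk a * PowerSeries.map (Nat.castRingHom ℚ) Θ) : ℚ) : ℂ) = (p : ℂ) * y) →
          ∀ n : ℕ, q ∣ n → ¬ q ^ 2 ∣ n →
            ‖((PowerSeries.coeff n (PowerSeries.mk a * PowerSeries.map (Nat.castRingHom ℚ) Θ) : ℚ) : ℚ_[p])‖ ≤ (p : ℝ)⁻¹) :=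
  jmlAll_six_of_socket hA fun _ _ hq0 γ _ _ hMC h00 h01 h10 h11 _ _ _ _ hLN hN3 V p hcoef F₀ hinv c₀ hF₀ h hV h' e hhe u hu ↦
    exists_isIntegral_lowerUnipotent_coeff hKatz hq0 γ hMC h00 h01 h10 h11 hLN hN3 V p hcoef F₀ hinv c₀ hF₀ h hV h' e hhe u hu


/-- **(RungAll⁶) FROM NF-A ∧ NF-Q** — «if Cohen's `H(k,·)` is ≡ 0 (mod p) on the (3,0)-refined `τ`-cut then it is ≡ 0 on the cut flipped at ANY odd
`q ∣ m`» (no flip condition): seat w8 g9's `rungAll_six_of_jmlAll` ∘ `jmlAll_six_of_facts`. CONDITIONAL on NF-A and NF-Q (hypotheses).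
[cite: Raum2023RamanujanTypeII, Prop. 2.3] [cite: Cohen1975, Thm. 3.1] [cite: Katz1973, §1.6 Cor. 1.6.2] -/
theorem rungAll_six_of_facts
    (hA : Cohen1975.thm31_cohenSeries_mem_halfIntModularForms)
    (hKatz : Katz1973_qExpansionPrinciple_allCusps) :
    ∀ (p : ℕ) [Fact p.Prime] (m : ℕ) [NeZero m] (χ : DirichletCharacter ℚ_[p] m) (k : ℕ),
      (p = 7 ∨ p = 11 ∨ p = 19 ∨ p = 43 ∨ p = 67 ∨ p = 163) →
      m.Coprime p → χ.IsPrimitive → χ.IsQuadratic → (k = (p + 1) / 4 ∨ k = (3 * p - 1) / 4) →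
      2 ≤ k → k ≤ p - 2 → χ (-1) * (-1) ^ k = -1 →
      ∀ (τ : ℕ → ℤ) (q : ℕ), q.Prime → q ∣ m → q ≠ 2 →
      (∀ q' : ℕ, q'.Prime → q' ∣ m → q' ≠ 2 → (τ q' = 1 ∨ τ q' = -1)) →
      (∀ a : ℕ, m ∣ a → a / m % 4 = 3 →
        (∀ q' : ℕ, q'.Prime → q' ∣ m → q' ≠ 2 → jacobiSym (-((a / m : ℕ) : ℤ)) q' = τ q') →
        (2 ∣ m → a / m % 8 = 7) → ¬ 3 ∣ a / m → ‖((cohenH k a : ℚ) : ℚ_[p])‖ ≤ (p : ℝ)⁻¹) →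
      ∀ a : ℕ, m ∣ a → a / m % 4 = 3 →
        (∀ q' : ℕ, q'.Prime → q' ∣ m → q' ≠ 2 → jacobiSym (-((a / m : ℕ) : ℤ)) q' = (if q' = q then -τ q' else τ q')) →
        (2 ∣ m → a / m % 8 = 7) → ¬ 3 ∣ a / m → ‖((cohenH k a : ℚ) : ℚ_[p])‖ ≤ (p : ℝ)⁻¹ :=
  rungAll_six_of_jmlAll (jmlAll_six_of_facts hA hKatz)

/-- **(FlipRungAll⁶) = registry v29's `stub_flipRungs.1` FROM NF-A ∧ NF-Q** — LEAD g14's flipped-cusp rung in Bernoulli currency WITHOUT the flip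
condition `¬ (p ∣ q·J(−1|q) − 1)`: seat w2 g15's `flipRungAll_six_of_rungAll` ∘ `rungAll_six_of_facts`. CONDITIONAL on NF-A and NF-Q (hypotheses,
the cite-only bundle `stub_printsCohenKatzCusps`). [cite: Raum2023RamanujanTypeII, Prop. 2.3] [cite: Cohen1975, Thm. 3.1] [cite: Katz1973, §1.6 Cor. 1.6.2] -/
theorem flipRungAll_six_of_facts
    (hA : Cohen1975.thm31_cohenSeries_mem_halfIntModularForms)
    (hKatz : Katz1973_qExpansionPrinciple_allCusps) :
    ∀ (p : ℕ) [Fact p.Prime] (m : ℕ) [NeZero m] (χ : DirichletCharacter ℚ_[p] m) (k : ℕ),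
      (p = 7 ∨ p = 11 ∨ p = 19 ∨ p = 43 ∨ p = 67 ∨ p = 163) →
      m.Coprime p → χ.IsPrimitive → χ.IsQuadratic → (k = (p + 1) / 4 ∨ k = (3 * p - 1) / 4) →
      2 ≤ k → k ≤ p - 2 → χ (-1) * (-1) ^ k = -1 →
      ∀ (τ : ℕ → ℤ) (q : ℕ), q.Prime → q ∣ m → q ≠ 2 →
      (∀ q' : ℕ, q'.Prime → q' ∣ m → q' ≠ 2 → (τ q' = 1 ∨ τ q' = -1)) →
      (∀ (K₀ : Type) [Field K₀] [NumberField K₀] (ε₀ : DirichletCharacter ℚ_[p] (NumberField.discr K₀).natAbs),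
        IsImaginaryQuadratic K₀ → Odd (NumberField.discr K₀) → NumberField.discr K₀ < -4 →
        ¬ ((3 : ℤ) ∣ NumberField.discr K₀) →
        (∀ q' : ℕ, q'.Prime → q' ∣ m → q' ≠ 2 → jacobiSym (NumberField.discr K₀) q' = τ q') →
        (2 ∣ m → NumberField.discr K₀ % 8 = 1) → IsKroneckerCharacterOf K₀ ε₀ →
        ‖(k : ℚ_[p])⁻¹ * @generalizedBernoulli ℚ_[p] _ _
            (changeLevel (dvd_mul_right m (NumberField.discr K₀).natAbs) χ *
              changeLevel (dvd_mul_left (NumberField.discr K₀).natAbs m) ε₀).conductor ⟨conductor_ne_zero _⟩ k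
            (changeLevel (dvd_mul_right m (NumberField.discr K₀).natAbs) χ *
              changeLevel (dvd_mul_left (NumberField.discr K₀).natAbs m) ε₀).primitiveCharacter‖ ≤ (p : ℝ)⁻¹) →
      ∀ (K₀ : Type) [Field K₀] [NumberField K₀] (ε₀ : DirichletCharacter ℚ_[p] (NumberField.discr K₀).natAbs),
        IsImaginaryQuadratic K₀ → Odd (NumberField.discr K₀) → NumberField.discr K₀ < -4 →
        ¬ ((3 : ℤ) ∣ NumberField.discr K₀) →
        (∀ q' : ℕ, q'.Prime → q' ∣ m → q' ≠ 2 → jacobiSym (NumberField.discr K₀) q' = (if q' = q then -τ q' else τ q')) →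
        (2 ∣ m → NumberField.discr K₀ % 8 = 1) → IsKroneckerCharacterOf K₀ ε₀ →
        ‖(k : ℚ_[p])⁻¹ * @generalizedBernoulli ℚ_[p] _ _
            (changeLevel (dvd_mul_right m (NumberField.discr K₀).natAbs) χ *
              changeLevel (dvd_mul_left (NumberField.discr K₀).natAbs m) ε₀).conductor ⟨conductor_ne_zero _⟩ k
            (changeLevel (dvd_mul_right m (NumberField.discr K₀).natAbs) χ *
              changeLevel (dvd_mul_left (NumberField.discr K₀).natAbs m) ε₀).primitiveCharacter‖ ≤ (p : ℝ)⁻¹ :=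
  flipRungAll_six_of_rungAll (rungAll_six_of_facts hA hKatz)

end Summit.BirchSwinnertonDyer.BirchSwinnertonDyer.Theorems.PrintCFram.FlipRung

end
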